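import Mathlib
import Literature.Analysis.ValidatedNumerics.WeightedEllOneSequenceAlgebra
import Literature.Analysis.ValidatedNumerics.ConeMonomialLaplacian
import HarnessLib

/-!
# The termwise Dirichlet inverse on the weighted cone algebra `ℓ¹_ϱ(ℕ × ℕ)` as a kernel operator

Topic `Literature/Analysis/ValidatedNumerics`.  Companion of `ConeMonomialLaplacian.lean`
(`ConeMonomial.lapRI_monomial`, `monomial_boundary`, `dirichletInverse_weight_le`: the disk monomials
`M_{a,b}(z) = z^a z̄^b`, their Laplacian `4ab z^{a−1} z̄^{b−1}`, the termwise Dirichlet inverse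
`Δ_D⁻¹ M_{a,b} = (M_{a+1,b+1} − M_{a−b,0})/(4(a+1)(b+1))` (`b ≤ a`; `M_{0,b−a}` otherwise) and the
per-column weight inequality) and of `WeightedEllOneSequenceAlgebra.lean` (`WeightedSeq.ColBound`,
`WeightedSeq.wnorm_apply_le`: operator norm `ℓ¹_ω → ℓ¹_ω` by weighted column sums).  This file writes
`Δ_D⁻¹` as the real KERNEL `dirichletInvKer k m` on the index `ℕ × ℕ` of the cone algebra of real
coefficient families `u = Σ u_{ab} ζ^a ζ̄^b`, `‖u‖_ϱ = Σ |u_{ab}| ϱ^{a+b}` (weight `coneWeight ϱ`), and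
PROVES the two operator-norm statements the certnum F2 (B″)/(B-SL) certificates use as constants:

* `colBound_dirichletInvKer` — **all columns:** `Σ_k |Δ_D⁻¹(k,m)| ϱ^{|k|} ≤ (ϱ²+1)/4 · ϱ^{|m|}`
  (`ϱ ≥ 1`; the worst column is `m = (0,0)`, `Δ_D⁻¹ 1 = (zz̄ − 1)/4`), hence
  `‖Δ_D⁻¹ s‖_ϱ ≤ (ϱ²+1)/4 · ‖s‖_ϱ` (`wnorm_apply_dirichletInvKer_le`) — the factor of the producer's
  `κ = ‖A‖(ϱ²+1)/4` in `Z_err` and `Z₂(r)`;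
* `colBound_dirichletInvKerFar` — **far columns** `a + b ≥ N + 1` (kernel `dirichletInvKerFar N` =
  `Δ_D⁻¹ ∘ (I − P_N)`): column bound `(ϱ²+1)/(4(N+2))`, hence
  `‖Δ_D⁻¹ (I − P_N) s‖_ϱ ≤ (ϱ²+1)/(4(N+2)) · ‖s‖_ϱ` (`wnorm_apply_dirichletInvKerFar_le`) — the
  `Z_far` constant; this is the `ℓ¹_ϱ` operator form of `ConeMonomial.dirichletInverse_weight_le`.

Also recorded, symbol by symbol as a replay reads them: the two nonzero entries of each column
(`dirichletInvKer_apply_raise`, `dirichletInvKer_apply_harm`), that they sit at distinct indices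
(`raise_ne_harmIndex`), the vanishing elsewhere (`dirichletInvKer_eq_zero`), and the exact weighted
column sum `(ϱ^{a+b+2} + ϱ^{|a−b|})/(4(a+1)(b+1))` (`colSum_dirichletInvKer`).

## Source

G. Arioli, H. Koch, *Non-radial solutions for some semilinear elliptic equations on the disk*,
Nonlinear Anal. 179 (2019) 294–308 [ArioliKoch2019]: §2 Lemma 2.1 (the Dirichlet inverse of the
Laplacian on the disk-polynomial / Zernike basis, termwise: `Δ⁻¹V_n^m = c₂V_{n+2}^m + c₁V_n^m + c₀V_{n−2}^m`),
§3 Prop. 3.2 eq. (3.7) (the operator bound `‖Δ⁻¹(I − P_N)‖ ≤ (ρ+ρ⁻¹)²/(4N(N+2))` on their algebra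
`B_ρ`).  As in `ConeMonomialLaplacian.lean`, the statements here are the PLAIN-MONOMIAL analogues
(constant `(ϱ²+1)/(4(N+2))`, no extra `1/N`), obtained the same way from the explicit inverse; the
operator-norm-by-columns principle is [HungriaLessardMirelesJames2016] Cor. 1
(`WeightedSeq.wnorm_apply_le`).

## What is NOT covered

No statement that `dirichletInvKer` inverts an abstract Laplacian on a function space: the analytic
content (`Δ` of each column's function is the monomial, zero boundary values on `|z| = 1`) is
`ConeMonomial.lapRI_monomial` / `monomial_boundary`, column by column; convergence questions do not
arise for the finitely supported families a certificate manipulates (`WeightedSeq.apply_eq_sum`).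
Real coefficient families only (the producer's cone arithmetic `coneq.py` stores real dyadic
coefficients; a real-valued function has a symmetric family `u_{ab} = u_{ba}`).

## Provenance

AI-produced formalisation (cell certnum, seat certnum-ode-2, 2026-08-27) — the `ℓ¹_ϱ` operator
packaging announced in `ConeMonomialLaplacian.lean`'s WHAT-THIS-IS-NOT and in
`pub/certnum/ode/RADII-SPEC.md` §3 (S4).
-/

set_option autoImplicit false

open scoped BigOperators
open Finset

noncomputable section

namespace Literature.Analysis.ValidatedNumerics

namespace ConeMonomial

open WeightedSeq

/-! ### The cone weight and the kernel -/

/-- The weight of the cone algebra: `ω_ϱ(a,b) = ϱ^{a+b}` (`‖Σ u_{ab} ζ^aζ̄^b‖_ϱ = Σ |u_{ab}| ϱ^{a+b}`).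
[cite: ArioliKoch2019, §3 eq. (3.2)–(3.4) (the weighted norm of the disk algebra, monomial version)] -/
def coneWeight (ϱ : ℝ) (i : ℕ × ℕ) : ℝ := ϱ ^ (i.1 + i.2)

/-- [cite: ArioliKoch2019, §3 (weights are positive for ρ > 0)] -/
theorem coneWeight_pos {ϱ : ℝ} (hϱ : 0 < ϱ) (i : ℕ × ℕ) : 0 < coneWeight ϱ i := pow_pos hϱ _

/-- [cite: ArioliKoch2019, §3 (weights are nonnegative)] -/
theorem coneWeight_nonneg {ϱ : ℝ} (hϱ : 0 ≤ ϱ) (i : ℕ × ℕ) : 0 ≤ coneWeight ϱ i := pow_nonneg hϱ _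

/-- The index raised by the inverse: `(a,b) ↦ (a+1,b+1)` (the `z^{a+1} z̄^{b+1}` term).
[cite: ArioliKoch2019, §2 Lemma 2.1 (the V_{n+2} term of Δ⁻¹)] -/
def raise (m : ℕ × ℕ) : ℕ × ℕ := (m.1 + 1, m.2 + 1)

/-- The index of the harmonic boundary correction: `(a−b, 0)` if `b ≤ a`, else `(0, b−a)`
(the term `z^{a−b}`, resp. `z̄^{b−a}`, subtracted to enforce zero boundary values).
[cite: ArioliKoch2019, §2 Lemma 2.1 (boundary correction of the termwise inverse)] -/
def harmIndex (m : ℕ × ℕ) : ℕ × ℕ := if m.2 ≤ m.1 then (m.1 - m.2, 0) else (0, m.2 - m.1)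

/-- The common factor `1/(4(a+1)(b+1))` of column `(a,b)`.
[cite: ArioliKoch2019, §2 eq. (2.10) and Lemma 2.1 (the coefficients of Δ⁻¹)] -/
def invFactor (m : ℕ × ℕ) : ℝ := 1 / (4 * ((m.1 : ℝ) + 1) * ((m.2 : ℝ) + 1))

/-- **The Dirichlet-inverse kernel** on the cone index: column `m = (a,b)` of `Δ_D⁻¹` has the entry
`+1/(4(a+1)(b+1))` at `raise m = (a+1,b+1)`, the entry `−1/(4(a+1)(b+1))` at `harmIndex m`, and
zeros elsewhere — i.e. `Δ_D⁻¹(z^a z̄^b) = (z^{a+1}z̄^{b+1} − z^{a−b})/(4(a+1)(b+1))` read as a matrix.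
[cite: ArioliKoch2019, §2 Lemma 2.1 (termwise Dirichlet inverse; monomial version)] -/
def dirichletInvKer (k m : ℕ × ℕ) : ℝ :=
  (if k = raise m then invFactor m else 0) - (if k = harmIndex m then invFactor m else 0)

/-- The far-column kernel `Δ_D⁻¹ ∘ (I − P_N)`: columns of total degree `a + b ≥ N + 1` only.
[cite: ArioliKoch2019, §3 Prop. 3.2 (the operator Δ⁻¹(I − P_N))] -/
def dirichletInvKerFar (N : ℕ) (k m : ℕ × ℕ) : ℝ :=
  if N + 1 ≤ m.1 + m.2 then dirichletInvKer k m else 0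

/-! ### The entries, symbol by symbol -/

/-- The two nonzero entries of a column sit at different indices (`harmIndex` has a zero
coordinate, `raise` has none). [cite: ArioliKoch2019, §2 Lemma 2.1] -/
theorem raise_ne_harmIndex (m : ℕ × ℕ) : raise m ≠ harmIndex m := by
  unfold raise harmIndex
  split_ifs with h
  · intro e; have := congrArg Prod.snd e; simp at this
  · intro e; have := congrArg Prod.fst e; simp at this

/-- [cite: ArioliKoch2019, §2 Lemma 2.1 (coefficient 1/(4(a+1)(b+1)) > 0)] -/
theorem invFactor_pos (m : ℕ × ℕ) : 0 < invFactor m := by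
  unfold invFactor; positivity

/-- Entry at the raised index: `Δ_D⁻¹(raise m, m) = 1/(4(a+1)(b+1))`.
[cite: ArioliKoch2019, §2 Lemma 2.1] -/
theorem dirichletInvKer_apply_raise (m : ℕ × ℕ) : dirichletInvKer (raise m) m = invFactor m := by
  unfold dirichletInvKer
  rw [if_pos rfl, if_neg (raise_ne_harmIndex m), sub_zero]

/-- Entry at the harmonic index: `Δ_D⁻¹(harmIndex m, m) = −1/(4(a+1)(b+1))`.
[cite: ArioliKoch2019, §2 Lemma 2.1] -/
theorem dirichletInvKer_apply_harm (m : ℕ × ℕ) : dirichletInvKer (harmIndex m) m = -invFactor m := by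
  unfold dirichletInvKer
  rw [if_neg (fun h => raise_ne_harmIndex m h.symm), if_pos rfl, zero_sub]

/-- All other entries of the column vanish. [cite: ArioliKoch2019, §2 Lemma 2.1] -/
theorem dirichletInvKer_eq_zero {k m : ℕ × ℕ} (h1 : k ≠ raise m) (h2 : k ≠ harmIndex m) :
    dirichletInvKer k m = 0 := by
  unfold dirichletInvKer
  rw [if_neg h1, if_neg h2, sub_zero]

/-- Weight of the raised index: `ϱ^{a+b+2}`. [cite: ArioliKoch2019, §3 (‖V‖_ρ = ρ^{deg})] -/
theorem coneWeight_raise (ϱ : ℝ) (m : ℕ × ℕ) : coneWeight ϱ (raise m) = ϱ ^ (m.1 + m.2 + 2) := by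
  unfold coneWeight raise
  congr 1
  simp only
  ring

/-- Weight of the harmonic index: `ϱ^{a−b}` (`b ≤ a`) resp. `ϱ^{b−a}`; in either case `≤ ϱ^{a+b}` for
`ϱ ≥ 1`. [cite: ArioliKoch2019, §3 (‖V‖_ρ = ρ^{deg})] -/
theorem coneWeight_harmIndex_le {ϱ : ℝ} (hϱ : 1 ≤ ϱ) (m : ℕ × ℕ) :
    coneWeight ϱ (harmIndex m) ≤ ϱ ^ (m.1 + m.2) := by
  unfold coneWeight harmIndex
  split_ifs with h
  · exact pow_le_pow_right₀ hϱ (by simp only [add_zero]; omega)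
  · exact pow_le_pow_right₀ hϱ (by simp only [zero_add]; omega)

/-! ### Column sums and the two operator bounds -/

/-- **Exact weighted column sum** of `Δ_D⁻¹`: over the support `{raise m, harmIndex m}`,
`Σ_k |Δ_D⁻¹(k,m)| ϱ^{|k|} = (ϱ^{a+b+2} + ϱ^{|a−b|})/(4(a+1)(b+1))`
(= `invFactor m · (coneWeight ϱ (raise m) + coneWeight ϱ (harmIndex m))`).
[cite: ArioliKoch2019, §3 Prop. 3.2 (column norms of the termwise inverse; monomial version)] -/
theorem colSum_dirichletInvKer (ϱ : ℝ) (m : ℕ × ℕ) :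
    ∑ k ∈ ({raise m, harmIndex m} : Finset (ℕ × ℕ)), |dirichletInvKer k m| * coneWeight ϱ k
      = invFactor m * (coneWeight ϱ (raise m) + coneWeight ϱ (harmIndex m)) := by
  rw [sum_pair (raise_ne_harmIndex m), dirichletInvKer_apply_raise, dirichletInvKer_apply_harm,
    abs_neg, abs_of_pos (invFactor_pos m)]
  ring

/-- The support of column `m` is contained in `{raise m, harmIndex m}`.
[cite: ArioliKoch2019, §2 Lemma 2.1] -/
theorem dirichletInvKer_eq_zero_of_not_mem {k m : ℕ × ℕ}
    (hk : k ∉ ({raise m, harmIndex m} : Finset (ℕ × ℕ))) : dirichletInvKer k m = 0 := by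
  rw [mem_insert, mem_singleton, not_or] at hk
  exact dirichletInvKer_eq_zero hk.1 hk.2

/-- The per-column inequality behind the all-columns bound: for `ϱ ≥ 1`,
`(ϱ^{a+b+2} + ϱ^{|a−b|})/(4(a+1)(b+1)) ≤ (ϱ²+1)/4 · ϱ^{a+b}` (worst case `a = b = 0`).
[cite: ArioliKoch2019, §3 Prop. 3.2 (monomial version, all columns)] -/
theorem colSum_dirichletInvKer_le {ϱ : ℝ} (hϱ : 1 ≤ ϱ) (m : ℕ × ℕ) :
    invFactor m * (coneWeight ϱ (raise m) + coneWeight ϱ (harmIndex m))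
      ≤ (ϱ ^ 2 + 1) / 4 * coneWeight ϱ m := by
  have hϱ0 : 0 < ϱ := lt_of_lt_of_le one_pos hϱ
  have hw : coneWeight ϱ (raise m) + coneWeight ϱ (harmIndex m) ≤ (ϱ ^ 2 + 1) * coneWeight ϱ m := by
    rw [coneWeight_raise, add_mul, one_mul]
    unfold coneWeight
    have := coneWeight_harmIndex_le hϱ m
    unfold coneWeight at this
    nlinarith [pow_add ϱ (m.1 + m.2) 2]
  have hf : invFactor m ≤ 1 / 4 := by
    unfold invFactor
    rw [div_le_div_iff₀ (by positivity) (by norm_num)]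
    have ha : (0 : ℝ) ≤ m.1 := Nat.cast_nonneg _
    have hb : (0 : ℝ) ≤ m.2 := Nat.cast_nonneg _
    nlinarith [mul_nonneg ha hb]
  have hwpos : 0 ≤ coneWeight ϱ (raise m) + coneWeight ϱ (harmIndex m) :=
    add_nonneg (coneWeight_nonneg hϱ0.le _) (coneWeight_nonneg hϱ0.le _)
  calc invFactor m * (coneWeight ϱ (raise m) + coneWeight ϱ (harmIndex m))
      ≤ (1 / 4) * ((ϱ ^ 2 + 1) * coneWeight ϱ m) :=
        mul_le_mul hf hw hwpos (by norm_num)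
    _ = (ϱ ^ 2 + 1) / 4 * coneWeight ϱ m := by ring

/-- **All-columns bound:** `Δ_D⁻¹` has the weighted column bound `(ϱ²+1)/4` on `ℓ¹_ϱ(ℕ × ℕ)`, `ϱ ≥ 1`.
[cite: ArioliKoch2019, §3 Prop. 3.2 (operator norm of the termwise inverse; monomial version, N = 0)] -/
theorem colBound_dirichletInvKer {ϱ : ℝ} (hϱ : 1 ≤ ϱ) :
    ColBound (coneWeight ϱ) (coneWeight ϱ) dirichletInvKer ((ϱ ^ 2 + 1) / 4) := by
  have hϱ0 : 0 < ϱ := lt_of_lt_of_le one_pos hϱ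
  refine colBound_of_finset (fun k => coneWeight_nonneg hϱ0.le k) fun m => ?_
  refine ⟨{raise m, harmIndex m}, fun k hk => dirichletInvKer_eq_zero_of_not_mem hk, ?_⟩
  rw [colSum_dirichletInvKer]
  exact colSum_dirichletInvKer_le hϱ m

/-- **`‖Δ_D⁻¹ s‖_ϱ ≤ (ϱ²+1)/4 · ‖s‖_ϱ`** for every `s ∈ ℓ¹_ϱ(ℕ × ℕ)` (and `Δ_D⁻¹ s ∈ ℓ¹_ϱ`): the factor
of the certnum producer's `κ = ‖A‖·(ϱ²+1)/4`.
[cite: ArioliKoch2019, §3 Prop. 3.2; HungriaLessardMirelesJames2016 Cor. 1 (operator norm by columns)] -/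
theorem wnorm_apply_dirichletInvKer_le {ϱ : ℝ} (hϱ : 1 ≤ ϱ) {s : ℕ × ℕ → ℝ}
    (hs : Mem (coneWeight ϱ) s) :
    Mem (coneWeight ϱ) (apply dirichletInvKer s) ∧
      wnorm (coneWeight ϱ) (apply dirichletInvKer s) ≤ (ϱ ^ 2 + 1) / 4 * wnorm (coneWeight ϱ) s := by
  have hϱ0 : 0 < ϱ := lt_of_lt_of_le one_pos hϱ
  exact wnorm_apply_le (fun i => coneWeight_nonneg hϱ0.le i) (fun k => coneWeight_nonneg hϱ0.le k)
    (by positivity) (colBound_dirichletInvKer hϱ) hs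

/-- **Far-columns bound (`Z_far`):** `Δ_D⁻¹ ∘ (I − P_N)` has the weighted column bound
`(ϱ²+1)/(4(N+2))` on `ℓ¹_ϱ(ℕ × ℕ)`, `ϱ ≥ 1` — the `ℓ¹_ϱ` operator form of
`ConeMonomial.dirichletInverse_weight_le` / `_le'`.
[cite: ArioliKoch2019, §3 Prop. 3.2 eq. (3.7) (‖Δ⁻¹(I − P_N)‖; monomial-basis analogue)] -/
theorem colBound_dirichletInvKerFar {ϱ : ℝ} (hϱ : 1 ≤ ϱ) (N : ℕ) :
    ColBound (coneWeight ϱ) (coneWeight ϱ) (dirichletInvKerFar N) ((ϱ ^ 2 + 1) / (4 * ((N : ℝ) + 2))) := by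
  have hϱ0 : 0 < ϱ := lt_of_lt_of_le one_pos hϱ
  refine colBound_of_finset (fun k => coneWeight_nonneg hϱ0.le k) fun m => ?_
  by_cases hN : N + 1 ≤ m.1 + m.2
  · refine ⟨{raise m, harmIndex m}, fun k hk => ?_, ?_⟩
    · unfold dirichletInvKerFar
      rw [if_pos hN, dirichletInvKer_eq_zero_of_not_mem hk]
    · have e : ∀ k, |dirichletInvKerFar N k m| * coneWeight ϱ k = |dirichletInvKer k m| * coneWeight ϱ k := by
        intro k; unfold dirichletInvKerFar; rw [if_pos hN]
      rw [sum_congr rfl fun k _ => e k, colSum_dirichletInvKer, coneWeight_raise]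
      -- the per-column inequality of `ConeMonomialLaplacian.lean`
      unfold invFactor coneWeight harmIndex
      split_ifs with hba
      · have h := dirichletInverse_weight_le (N := N) hϱ hba hN
        simp only [add_zero]
        rw [one_div, inv_mul_eq_div]
        calc (ϱ ^ (m.1 + m.2 + 2) + ϱ ^ (m.1 - m.2)) / (4 * ((m.1 : ℝ) + 1) * ((m.2 : ℝ) + 1))
            ≤ ϱ ^ (m.1 + m.2) * ((ϱ ^ 2 + 1) / (4 * ((N : ℝ) + 2))) := h
          _ = (ϱ ^ 2 + 1) / (4 * ((N : ℝ) + 2)) * ϱ ^ (m.1 + m.2) := mul_comm _ _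
      · have h := dirichletInverse_weight_le' (N := N) hϱ (le_of_lt (not_le.1 hba)) hN
        simp only [zero_add]
        rw [one_div, inv_mul_eq_div]
        calc (ϱ ^ (m.1 + m.2 + 2) + ϱ ^ (m.2 - m.1)) / (4 * ((m.1 : ℝ) + 1) * ((m.2 : ℝ) + 1))
            ≤ ϱ ^ (m.1 + m.2) * ((ϱ ^ 2 + 1) / (4 * ((N : ℝ) + 2))) := h
          _ = (ϱ ^ 2 + 1) / (4 * ((N : ℝ) + 2)) * ϱ ^ (m.1 + m.2) := mul_comm _ _
  · refine ⟨∅, fun k _ => ?_, ?_⟩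
    · unfold dirichletInvKerFar; rw [if_neg hN]
    · rw [sum_empty]
      exact mul_nonneg (by positivity) (coneWeight_nonneg hϱ0.le m)

/-- **`‖Δ_D⁻¹ (I − P_N) s‖_ϱ ≤ (ϱ²+1)/(4(N+2)) · ‖s‖_ϱ`** for every `s ∈ ℓ¹_ϱ(ℕ × ℕ)`: the `Z_far`
constant of the certnum F2 (B″)/(B-SL) certificates as an operator statement.
[cite: ArioliKoch2019, §3 Prop. 3.2 eq. (3.7); HungriaLessardMirelesJames2016 Cor. 1] -/
theorem wnorm_apply_dirichletInvKerFar_le {ϱ : ℝ} (hϱ : 1 ≤ ϱ) (N : ℕ) {s : ℕ × ℕ → ℝ}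
    (hs : Mem (coneWeight ϱ) s) :
    Mem (coneWeight ϱ) (apply (dirichletInvKerFar N) s) ∧
      wnorm (coneWeight ϱ) (apply (dirichletInvKerFar N) s)
        ≤ (ϱ ^ 2 + 1) / (4 * ((N : ℝ) + 2)) * wnorm (coneWeight ϱ) s := by
  have hϱ0 : 0 < ϱ := lt_of_lt_of_le one_pos hϱ
  exact wnorm_apply_le (fun i => coneWeight_nonneg hϱ0.le i) (fun k => coneWeight_nonneg hϱ0.le k)
    (by positivity) (colBound_dirichletInvKerFar hϱ N) hs

end ConeMonomial

end Literature.Analysis.ValidatedNumerics
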